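import Mathlib.Data.List.Basic
import HarnessLib

/-!
# Route `FordMaynardSieveConst01651`, target `SieveConst01651` (stmt-Parity-19185), stub `stub_certValuePos` (R2):
# the VOLTERRA TABLE — an exact-integer enclosure of Buchstab's function `Φ₆` (definitions)

Definitions only (the checker's data path; soundness and kernel evaluation are separate def-free files).
`Φ₆ = Σ_{m ≤ 6} φ_{ν₀}^{⋆m}/m!` solves `x Φ₆(x) = 1 + Ψ(x − ν₀)`, `Ψ(y) = ∫_{(0,y]} Φ₆`, on `(ν₀, 7ν₀)`
(`…BuchstabKernel.buchstab_volterra_six`); `Ψ` is monotone and vanishes on `(−∞, ν₀]`.  On the grid `x_i = i/J`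
with `ν₀ = K/J` (`J = 10000·n`, `K = 1651·n`) this gives the monotone integer recursion (scale `D`, directed rounding)

  `Φ⁻_i = ⌊(D + Ψ⁻_{i−K})·J/(i+1)⌋`, `Φ⁺_i = ⌈(D + Ψ⁺_{i+1−K})·J/i⌉`  (bounds of `D·Φ₆` on the cell `(x_i, x_{i+1}]`),
  `Ψ⁻_{i+1} = Ψ⁻_i + ⌊Φ⁻_i/J⌋`, `Ψ⁺_{i+1} = Ψ⁺_i + ⌈Φ⁺_i/J⌉`  (bounds of `D·Ψ(x_{i+1})`), `Ψ^±_i = 0` for `i ≤ K`,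

organised by GENERATIONS `[gK, (g+1)K)` so that the lag-`K` look-back is a sequential walk over the previous
generation's output lists (`tabWalk`, structural recursion; `tabGen`, `tabNext`, `tabRun g`).  Python mirror
(`work/model/table_mirror.py` of the proving hand): `1 + Ψ(1 − ν₀)/… ∈ [3.4006671, 3.4007822]` at `n = 12`
(true `Φ₆(1) = 3.4007246`).

References: [FordMaynard2024PrimeSieves] arXiv:2407.14368, Theorem 7.3 (a), §8.2; A. A. Buchstab (1937).
-/

namespace Summit.Parity.GeneralizedHardyLittlewood.FordMaynardSieveConst01651SieveConst01651

/-- Output of a generation walk over the cells `i₀, …, i₀ + n − 1`: the cell bounds `Φ⁻, Φ⁺` (in order), the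
grid-point bounds `Ψ⁻, Ψ⁺` at `x_{i₀}, …, x_{i₀+n−1}`, and the final bounds `Ψ⁻, Ψ⁺` at `x_{i₀+n}` (all `D`-scaled
naturals). [folklore] -/
structure TabOut where
  /-- `Φ⁻` on the cells `i₀ … i₀+n−1`. -/
  phiLo : List ℕ
  /-- `Φ⁺` on the cells `i₀ … i₀+n−1`. -/
  phiHi : List ℕ
  /-- `Ψ⁻` at the grid points `i₀ … i₀+n−1`. -/
  psiLo : List ℕ
  /-- `Ψ⁺` at the grid points `i₀ … i₀+n−1`. -/
  psiHi : List ℕ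
  /-- `Ψ⁻` at the grid point `i₀ + n`. -/
  pl : ℕ
  /-- `Ψ⁺` at the grid point `i₀ + n`. -/
  ph : ℕ

/-- **The Volterra walk** (structural recursion on the number of remaining cells): arguments `J D i n ll lh pl ph`
and four reversed accumulators; `ll`/`lh` are the lagged lists `Ψ⁻_{i−K}, Ψ⁻_{i+1−K}, …` and `Ψ⁺_{i+1−K}, Ψ⁺_{i+2−K}, …`
consumed from the head. [folklore] -/
def tabWalk (J D : ℕ) : ℕ → ℕ → List ℕ → List ℕ → ℕ → ℕ → List ℕ → List ℕ → List ℕ → List ℕ → TabOut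
  | _, 0, _, _, pl, ph, a, b, c, d => ⟨a.reverse, b.reverse, c.reverse, d.reverse, pl, ph⟩
  | i, n + 1, ll, lh, pl, ph, a, b, c, d =>
      tabWalk J D (i + 1) n ll.tail lh.tail
        (pl + ((D + ll.headD 0) * J) / (i + 1) / J)
        (ph + (((D + lh.headD 0) * J + i - 1) / i + J - 1) / J)
        ((((D + ll.headD 0) * J) / (i + 1)) :: a) ((((D + lh.headD 0) * J + i - 1) / i) :: b) (pl :: c) (ph :: d)

/-- A generation walk from empty accumulators. [folklore] -/
def tabGen (J D i₀ n : ℕ) (ll lh : List ℕ) (pl ph : ℕ) : TabOut := tabWalk J D i₀ n ll lh pl ph [] [] [] []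

/-- The next generation (`K` cells from `g·K`) from the previous one: lag lists = previous `Ψ⁻` list and the previous
`Ψ⁺` list shifted by one (its last entry is the previous final value). [folklore] -/
def tabNext (J D K g : ℕ) (prev : TabOut) : TabOut :=
  tabGen J D (g * K) K prev.psiLo (prev.psiHi.tail ++ [prev.ph]) prev.pl prev.ph

/-- Generation `g ≥ 1` of the table (`g = 1`: cells `K … 2K−1` with zero lags; `Ψ ≡ 0` on `(−∞, ν₀]`). [folklore] -/
def tabRun (J D K : ℕ) : ℕ → TabOut
  | 0 => ⟨[], [], [], [], 0, 0⟩
  | 1 => tabGen J D K K (List.replicate K 0) (List.replicate K 0) 0 0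
  | g + 2 => tabNext J D K (g + 2) (tabRun J D K (g + 1))

/-- The route's parameters: `J = 120000` (`h = 1/J`; all cell edges of the `g₂` table, the band cut `8349/20000` and
`1/2` are grid points), `K = 19812 = ν₀·J`, `D = 2⁴⁰`. [folklore] -/
def tabJ : ℕ := 120000
/-- `K = ν₀ J = 19812`. [folklore] -/
def tabK : ℕ := 19812
/-- Fixed-point scale `D = 2⁴⁰`. [folklore] -/
def tabD : ℕ := 2 ^ 40

end Summit.Parity.GeneralizedHardyLittlewood.FordMaynardSieveConst01651SieveConst01651
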